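import Literature.NumberTheory.Automorphic.ArchGardingOneParamDeriv
import Literature.NumberTheory.Automorphic.ArchWhittakerCharNondegenerate
import HarnessLib

/-!
# Infinitesimal Whittaker equivariance: `ℓ(τ(x E_{ij}) v) = dψ_∞(x E_{ij}) ℓ(v)` for `i < j`

Topic `NumberTheory/Automorphic`; namespace `Literature.NumberTheory.Automorphic`. For a continuous
`ψ_∞`-Whittaker functional `ℓ` on the Gårding space of a strongly continuous Banach representation `τ` of
`GL_n(K_∞)` (`IsArchContWhittakerFunctional`: `ℓ(τ(u) v) = ψ_∞(u) ℓ(v)`, `u ∈ N_n(K_∞)`, and continuity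
for the `U(𝔤)`-seminorms), a Gårding vector `v`, indices `i < j` and `x ∈ K_∞`, the derivative along the
root direction `X = x E_{ij}` (`exp(sX) = 1 + s x E_{ij} ∈ N_n(K_∞)`) is

  `ℓ(τ(X) v) = -2πi Tr_{K_∞/ℝ}(x) ℓ(v)` if `j = i + 1`,   `ℓ(τ(X) v) = 0` otherwise

(`IsArchContWhittakerFunctional.apply_archDerivE_single`): differentiate `ℓ(τ(exp sX) v) = ψ_∞(exp sX) ℓ(v)`
at `s = 0` (`hasDerivAt_apply_expGL_of_normLe` on the left, the closed form
`ψ_∞(1 + x E_{ij}) = exp(-2πi Tr_{K_∞/ℝ} x)^{[j = i+1]}` of `ArchWhittakerCharNondegenerate` on the right).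
This is the infinitesimal form of the Whittaker condition (Kostant (1978), §2; Getz–Hahn (2024), Def. 11.3),
the hypothesis `IsWhittakerData` of the `𝔤𝔩₃` Casimir–Whittaker reduction. Everything is proved; the only
definition is the infinitesimal character `archWhittakerDChar`.

## References

* B. Kostant, *On Whittaker vectors and representation theory*, Invent. Math. 48 (1978), §2 [Kostant1978Whittaker].
* J. R. Getz, H. Hahn, *An Introduction to Automorphic Representations* (2024), Def. 11.3, Example 11.1 [GetzHahn2024].
-/

noncomputable section

open MeasureTheory Measure NumberField NumberField.mixedEmbedding IsDedekindDomain Set Filter Complex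
open scoped MatrixGroups Topology Classical ContDiff Matrix.Norms.Operator Real

namespace Literature.NumberTheory.Automorphic

variable {n : ℕ} {K : Type} [Field K] [NumberField K]

attribute [local instance] glInfBorel borelSpace_glInf locallyCompactSpace_glInf
  secondCountableTopology_glInf

-- as in `ArchGardingWhittaker`
set_option backward.isDefEq.respectTransparency false

/-! ### 1. `exp(s x E_{ij}) = 1 + s x E_{ij}` -/

/-- `exp y = 1 + y` for `y² = 0` in a Banach algebra (private copy of the tree's lemma of
`LeviConstantTermCenter`, to keep imports light). [folklore] -/
private theorem exp_eq_one_add_of_mul_self_eq_zero' {B : Type*} [Ring B] [Algebra ℝ B] [TopologicalSpace B]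
    [IsTopologicalRing B] [T2Space B] {y : B} (hy : y * y = 0) : NormedSpace.exp y = 1 + y := by
  rw [NormedSpace.exp_eq_tsum ℝ]
  dsimp only
  rw [tsum_eq_sum (s := Finset.range 2)]
  · simp [Finset.sum_range_succ]
  · intro m hm
    have h2 : 2 ≤ m := by rw [Finset.mem_range, not_lt] at hm; exact hm
    rw [pow_eq_zero_of_le h2 (by rw [pow_two, hy]), smul_zero]

omit [NumberField K] in
/-- `(s x E_{ij})² = 0` for `i ≠ j`. [folklore] -/
theorem smul_single_mul_self {i j : Fin n} (hij : i ≠ j) (x : mixedSpace K) (s : ℝ) :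
    (s • Matrix.single i j x) * (s • Matrix.single i j x) = 0 := by
  rw [Matrix.smul_mul, Matrix.mul_smul, Matrix.single_mul_single_of_ne (c := x) i j i hij.symm x, smul_zero, smul_zero]

/-- **`exp(s x E_{ij}) = 1 + (s x) E_{ij}`** as matrices, for `i ≠ j`. [folklore] -/
theorem coe_expGL_smul_single {i j : Fin n} (hij : i ≠ j) (x : mixedSpace K) (s : ℝ) :
    (expGL (s • Matrix.single i j x) : Matrix (Fin n) (Fin n) (mixedSpace K)) =
      Matrix.transvection i j (s • x) := by
  rw [coe_expGL, exp_eq_one_add_of_mul_self_eq_zero' (smul_single_mul_self hij x s), Matrix.transvection,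
    Matrix.smul_single]

/-- The unipotent element `u_s = exp(s x E_{ij}) ∈ N_n(K_∞)` for `i < j`. [folklore] -/
theorem exists_upperUnitriangular_coe_eq_expGL_smul_single {i j : Fin n} (hij : i < j) (x : mixedSpace K) (s : ℝ) :
    ∃ u : ↥(upperUnitriangular (Fin n) (mixedSpace K)),
      (u : GL (Fin n) (mixedSpace K)) = expGL (s • Matrix.single i j x) := by
  obtain ⟨u, hu⟩ := exists_upperUnitriangular_coe_eq_transvection (R := mixedSpace K) hij (s • x)
  refine ⟨u, Units.ext ?_⟩
  rw [hu, coe_expGL_smul_single hij.ne x s]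

/-! ### 2. The infinitesimal character and the equivariance -/

/-- **The infinitesimal generic character** on the root direction `x E_{ij}`, `i < j`:
`dψ_∞(x E_{ij}) = -2πi Tr_{K_∞/ℝ}(x)` if `j = i + 1` and `0` otherwise. [folklore] -/
def archWhittakerDChar (K : Type) [Field K] [NumberField K] {n : ℕ} (i j : Fin n) (x : mixedSpace K) : ℂ :=
  if (i : ℕ) + 1 = j then ((-(2 * π) * mixedTrace K x : ℝ) : ℂ) * I else 0

/-- **`s ↦ ψ_∞(exp(s x E_{ij}))` has derivative `dψ_∞(x E_{ij})` at `0`** (closed form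
`archWhittakerChar_of_coe_eq_transvection`). [folklore] -/
theorem hasDerivAt_archWhittakerChar_expGL_smul_single {i j : Fin n} (hij : i < j) (x : mixedSpace K)
    (u : ℝ → ↥(upperUnitriangular (Fin n) (mixedSpace K)))
    (hu : ∀ s, (u s : GL (Fin n) (mixedSpace K)) = expGL (s • Matrix.single i j x)) :
    HasDerivAt (fun s : ℝ => archWhittakerChar n K (u s)) (archWhittakerDChar K i j x) 0 := by
  have hval : ∀ s : ℝ, archWhittakerChar n K (u s) =
      if (i : ℕ) + 1 = j then cexp ((-(2 * π) * mixedTrace K (s • x) : ℝ) * I) else 1 := fun s =>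
    archWhittakerChar_of_coe_eq_transvection K (s • x) (u s) (by rw [hu s, coe_expGL_smul_single hij.ne x s])
  unfold archWhittakerDChar
  split_ifs with h
  · have hfun : (fun s : ℝ => archWhittakerChar n K (u s)) =
        fun s : ℝ => cexp (s • ((((-(2 * π) * mixedTrace K x : ℝ)) : ℂ) * I)) := by
      funext s
      rw [hval s, if_pos h, map_smul, smul_eq_mul]
      congr 1
      rw [Complex.real_smul]
      push_cast
      ring
    rw [hfun]
    have h1 : HasDerivAt (fun s : ℝ => s • ((((-(2 * π) * mixedTrace K x : ℝ)) : ℂ) * I))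
        ((((-(2 * π) * mixedTrace K x : ℝ)) : ℂ) * I) 0 := by
      simpa using (hasDerivAt_id (0 : ℝ)).smul_const ((((-(2 * π) * mixedTrace K x : ℝ)) : ℂ) * I)
    have h2 := (Complex.hasDerivAt_exp _).scomp (0 : ℝ) h1
    have h3 : HasDerivAt (fun s : ℝ => cexp (s • ((((-(2 * π) * mixedTrace K x : ℝ)) : ℂ) * I)))
        (((((-(2 * π) * mixedTrace K x : ℝ)) : ℂ) * I) •
          cexp ((0 : ℝ) • ((((-(2 * π) * mixedTrace K x : ℝ)) : ℂ) * I))) 0 := h2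
    simpa using h3
  · have hfun : (fun s : ℝ => archWhittakerChar n K (u s)) = fun _ => (1 : ℂ) := by
      funext s; rw [hval s, if_neg h]
    rw [hfun]
    exact hasDerivAt_const 0 1

section Equivariance

variable {hcpt : isCompact_glFiniteIntegralLevel n K}
  {E : Type*} [NormedAddCommGroup E] [NormedSpace ℂ E] [CompleteSpace E]
  {τ : ContRepresentation ℂ (AutomorphyDatum.gl n K hcpt).arch.carrier E} {hτ : τ.IsStronglyContinuous}
  {ℓ : archGardingSpace hcpt τ →ₗ[ℂ] ℂ}

/-- **Infinitesimal Whittaker equivariance along a root direction**: for a continuous `ψ_∞`-Whittaker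
functional `ℓ`, a Gårding vector `v`, `i < j` and `x ∈ K_∞`,
`ℓ(τ(x E_{ij}) v) = dψ_∞(x E_{ij}) ℓ(v)` — both sides are the derivative at `s = 0` of
`s ↦ ℓ(τ(exp(s x E_{ij})) v) = ψ_∞(exp(s x E_{ij})) ℓ(v)`. Kostant (1978), §2 (the character `η` on `𝔫`).
[cite: Kostant1978Whittaker, §2] -/
theorem IsArchContWhittakerFunctional.apply_archDerivE_single (hℓ : IsArchContWhittakerFunctional hcpt τ hτ ℓ)
    {i j : Fin n} (hij : i < j) (x : mixedSpace K) {v : E} (hv : v ∈ archGardingSpace hcpt τ) :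
    ℓ ⟨archDerivE hcpt τ (Matrix.single i j x) v, archDerivE_mem_archGardingSpace hτ _ hv⟩ =
      archWhittakerDChar K i j x * ℓ ⟨v, hv⟩ := by
  obtain ⟨u, hu⟩ : ∃ u : ℝ → ↥(upperUnitriangular (Fin n) (mixedSpace K)),
      ∀ s, (u s : GL (Fin n) (mixedSpace K)) = expGL (s • Matrix.single i j x) :=
    ⟨fun s => (exists_upperUnitriangular_coe_eq_expGL_smul_single hij x s).choose,
      fun s => (exists_upperUnitriangular_coe_eq_expGL_smul_single hij x s).choose_spec⟩
  -- the left derivative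
  have hL := hasDerivAt_apply_expGL_of_normLe hτ hℓ.norm_le (Matrix.single i j x) hv
  -- the same function through the Whittaker condition
  have hfun : (fun s : ℝ => ℓ ⟨τ (toArch hcpt (expGL (s • Matrix.single i j x))) v, apply_mem_archGardingSpace hτ _ hv⟩)
      = fun s => archWhittakerChar n K (u s) * ℓ ⟨v, hv⟩ := by
    funext s
    rw [← hℓ.map_unipotent (u s) ⟨v, hv⟩]
    congr 1
    apply Subtype.ext
    change τ (toArch hcpt (expGL (s • Matrix.single i j x))) v = τ (toArch hcpt (u s : GL (Fin n) (mixedSpace K))) v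
    rw [hu s]
  have hR : HasDerivAt (fun s : ℝ => archWhittakerChar n K (u s) * ℓ ⟨v, hv⟩)
      (archWhittakerDChar K i j x * ℓ ⟨v, hv⟩) 0 :=
    (hasDerivAt_archWhittakerChar_expGL_smul_single hij x u hu).mul_const _
  rw [hfun] at hL
  exact hL.unique hR

/-- The simple-root case: `ℓ(τ(x E_{i,i+1}) v) = -2πi Tr_{K_∞/ℝ}(x) ℓ(v)`. [folklore] -/
theorem IsArchContWhittakerFunctional.apply_archDerivE_single_simple (hℓ : IsArchContWhittakerFunctional hcpt τ hτ ℓ)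
    {i j : Fin n} (hij : (i : ℕ) + 1 = j) (x : mixedSpace K) {v : E} (hv : v ∈ archGardingSpace hcpt τ) :
    ℓ ⟨archDerivE hcpt τ (Matrix.single i j x) v, archDerivE_mem_archGardingSpace hτ _ hv⟩ =
      (((-(2 * π) * mixedTrace K x : ℝ) : ℂ) * I) * ℓ ⟨v, hv⟩ := by
  have hlt : i < j := by
    rw [Fin.lt_def]; omega
  rw [hℓ.apply_archDerivE_single hlt x hv, archWhittakerDChar, if_pos hij]

/-- The non-simple case: `ℓ(τ(x E_{ij}) v) = 0` for `j > i + 1`. [folklore] -/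
theorem IsArchContWhittakerFunctional.apply_archDerivE_single_of_ne (hℓ : IsArchContWhittakerFunctional hcpt τ hτ ℓ)
    {i j : Fin n} (hij : i < j) (hne : (i : ℕ) + 1 ≠ j) (x : mixedSpace K) {v : E}
    (hv : v ∈ archGardingSpace hcpt τ) :
    ℓ ⟨archDerivE hcpt τ (Matrix.single i j x) v, archDerivE_mem_archGardingSpace hτ _ hv⟩ = 0 := by
  rw [hℓ.apply_archDerivE_single hij x hv, archWhittakerDChar, if_neg hne, zero_mul]

end Equivariance

end Literature.NumberTheory.Automorphic
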